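import Summits.Ventures.Crystal3D.Theorems.StickyWulffConstantStackingLiminfLayerChainV4Defs
import Mathlib.Analysis.Calculus.ContDiff.Convolution
import Mathlib.Analysis.Asymptotics.Lemmas
import HarnessLib

/-!
# Stub (D) of line `LayerChain` v4 (crux `StackingLiminf`, stmt-Ventures-19145), part 1/2:
# the explicit mollifiers — `bump`, `dens`, `eta` — and the doubly mollified density `smooth` are `C²`,
# compactly supported, nonnegative

Cell `crystal3d-full`, venture `Summits/Ventures/Crystal3D`.  Registered stub (D) of the planner's line
LayerChain v4 (`HOME/cf-p1/route/lines/LayerChainV4.lean`, cf-p1 gen 13; vocabulary landed as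
`…StackingLiminfLayerChainV4Defs.lean`): for every configuration `x`, word `σ` and scales `1 ≤ K ≤ L`,

* the doubly mollified density `smooth x K L` (`w = η_L ∗_∥ Σ_i φ_K(· − x_i)`) is `C²`, compactly
  supported and nonnegative — `C²` because the one-variable profile `t ↦ (max 0 t)³` is `C²`
  (`contDiff_two_maxZero_cube`), so `bump`, `dens` are `C²`, and the lateral average is a convolution on
  `ℝ × ℝ` with the height as a parameter (`contDiffOn_convolution_right_with_param`);
* the window density `window σ K` of `−1` gaps is continuous with values in `[0,1]` — the two `finsum`s
  are locally finite sums of translates of the continuous compactly supported layer profile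
  `layerProf K` (`continuous_finsum`), and the denominator never vanishes because every height is within
  `h/2 < 1 ≤ K` of a layer and `layerProf K ζ > 0` for `|ζ| < K`.

This file: the `smooth` half (`contDiff_smooth`, `hasCompactSupport_smooth`, `smooth_nonneg`) and the bump
lemmas; part 2 (`…MollifierRegularity.lean`) does the window density and assembles
`stub_mollifierRegularity : MollifierRegularity` BY NAME.  WHAT THIS IS NOT: any inequality of the line;
routine analysis only.
-/

noncomputable section

namespace Summit.Ventures.Crystal3D.Theorems

open MeasureTheory Set Filter Function
open Summit.Ventures.Crystal3D.LayerChain (dot3)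
open Summit.Ventures.Crystal3D.Cruxes.StackingLiminf.LayerChainV4
open scoped Topology Convolution

/-! ### The one-variable profile `t ↦ (max 0 t)³` is `C²` -/

/-- Derivative of `t ↦ (max 0 t)^(n+2)`: `(n+2) (max 0 t)^(n+1)` (also at `t = 0`). -/
theorem hasDerivAt_maxZero_pow (n : ℕ) (t : ℝ) :
    HasDerivAt (fun s : ℝ => max 0 s ^ (n + 2)) ((n + 2 : ℕ) * max 0 t ^ (n + 1)) t := by
  rcases lt_trichotomy t 0 with ht | rfl | ht
  · -- locally the function is `0`
    have hev : (fun s : ℝ => max 0 s ^ (n + 2)) =ᶠ[𝓝 t] fun _ => 0 := by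
      filter_upwards [Iio_mem_nhds ht] with s hs
      rw [max_eq_left (le_of_lt hs), zero_pow (by omega)]
    rw [max_eq_left ht.le, zero_pow (by omega), mul_zero]
    exact (hasDerivAt_const t (0 : ℝ)).congr_of_eventuallyEq hev
  · -- at `0`: the increment is `O(s^{n+2}) = o(s)`
    rw [max_self, zero_pow (by omega), mul_zero]
    rw [hasDerivAt_iff_isLittleO_nhds_zero]
    simp only [max_self, zero_add, smul_zero, sub_zero, zero_pow (Nat.succ_ne_zero _)]
    have h1 : (fun s : ℝ => max 0 s ^ (n + 2)) =O[𝓝 0] fun s : ℝ => s ^ (n + 2) := by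
      refine Asymptotics.IsBigO.of_bound 1 (Filter.Eventually.of_forall fun s => ?_)
      rw [one_mul, Real.norm_eq_abs, Real.norm_eq_abs, abs_pow, abs_pow]
      refine pow_le_pow_left₀ (abs_nonneg _) ?_ _
      rcases le_total 0 s with hs | hs
      · rw [max_eq_right hs]
      · rw [max_eq_left hs, abs_zero]
        exact abs_nonneg _
    exact h1.trans_isLittleO (Asymptotics.isLittleO_pow_id (by omega))
  · -- locally the function is `s ^ (n+2)`
    have hev : (fun s : ℝ => max 0 s ^ (n + 2)) =ᶠ[𝓝 t] fun s => s ^ (n + 2) := by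
      filter_upwards [Ioi_mem_nhds ht] with s hs
      rw [max_eq_right (le_of_lt hs)]
    rw [max_eq_right ht.le]
    have h := hasDerivAt_pow (n + 2) t
    rw [show n + 2 - 1 = n + 1 by omega] at h
    exact h.congr_of_eventuallyEq hev

/-- `t ↦ (max 0 t)³` is `C²` (its second derivative is the continuous `6 · max 0 t`). -/
theorem contDiff_two_maxZero_cube : ContDiff ℝ 2 (fun t : ℝ => max 0 t ^ 3) := by
  have hd3 : ∀ t, HasDerivAt (fun s : ℝ => max 0 s ^ 3) ((3 : ℕ) * max 0 t ^ 2) t :=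
    hasDerivAt_maxZero_pow 1
  have hd2 : ∀ t, HasDerivAt (fun s : ℝ => max 0 s ^ 2) ((2 : ℕ) * max 0 t ^ 1) t :=
    hasDerivAt_maxZero_pow 0
  have hderiv3 : deriv (fun s : ℝ => max 0 s ^ 3) = fun t => (3 : ℝ) * max 0 t ^ 2 := by
    funext t; rw [(hd3 t).deriv]; norm_num
  have hderiv2 : deriv (fun t : ℝ => (3 : ℝ) * max 0 t ^ 2) = fun t => (6 : ℝ) * max 0 t := by
    funext t
    rw [((hd2 t).const_mul (3 : ℝ)).deriv]
    norm_num
    ring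
  rw [show (2 : WithTop ℕ∞) = ((1 : ℕ) : WithTop ℕ∞) + 1 by norm_num, contDiff_succ_iff_deriv]
  refine ⟨fun t => (hd3 t).differentiableAt, by simp, ?_⟩
  rw [hderiv3, show ((1 : ℕ) : WithTop ℕ∞) = ((0 : ℕ) : WithTop ℕ∞) + 1 by norm_num,
    contDiff_succ_iff_deriv]
  refine ⟨fun t => ((hd2 t).const_mul (3 : ℝ)).differentiableAt, by simp, ?_⟩
  rw [hderiv2]
  exact contDiff_zero.2 (by fun_prop)

/-! ### The bump, the density, the lateral kernel -/

/-- The normalising constant of the bump is positive. -/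
theorem bumpConst_pos : 0 < bumpConst := by
  unfold bumpConst; positivity

/-- `dot3 u u` as a smooth function of `u`. -/
theorem contDiff_dot3_self : ContDiff ℝ 2 (fun u : Fin 3 → ℝ => dot3 u u) := by
  unfold dot3; fun_prop

/-- `dot3 u u ≥ 0`. -/
theorem dot3_self_nonneg (u : Fin 3 → ℝ) : 0 ≤ dot3 u u := by
  unfold dot3; nlinarith [sq_nonneg (u 0), sq_nonneg (u 1), sq_nonneg (u 2)]

/-- Each squared coordinate is at most `dot3 u u`. -/
theorem sq_le_dot3_self (u : Fin 3 → ℝ) (j : Fin 3) : u j ^ 2 ≤ dot3 u u := by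
  unfold dot3
  fin_cases j <;> simp <;> nlinarith [sq_nonneg (u 0), sq_nonneg (u 1), sq_nonneg (u 2)]

/-- The bump is `C²`. -/
theorem contDiff_bump (K : ℝ) : ContDiff ℝ 2 (bump K) := by
  have h : bump K = fun u => bumpConst / K ^ 3 * ((fun t : ℝ => max 0 t ^ 3) (1 - dot3 u u / K ^ 2)) := by
    funext u; rfl
  rw [h]
  exact contDiff_const.mul (contDiff_two_maxZero_cube.comp
    (contDiff_const.sub (contDiff_dot3_self.div_const _)))

/-- The bump is continuous. -/
theorem continuous_bump (K : ℝ) : Continuous (bump K) := (contDiff_bump K).continuous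

/-- The bump is nonnegative (for `K > 0`). -/
theorem bump_nonneg {K : ℝ} (hK : 0 < K) (u : Fin 3 → ℝ) : 0 ≤ bump K u := by
  unfold bump
  exact mul_nonneg (div_nonneg bumpConst_pos.le (pow_nonneg hK.le _))
    (pow_nonneg (le_max_left _ _) _)

/-- The bump vanishes where `|u|² ≥ K²`. -/
theorem bump_eq_zero {K : ℝ} (hK : 0 < K) {u : Fin 3 → ℝ} (hu : K ^ 2 ≤ dot3 u u) :
    bump K u = 0 := by
  unfold bump
  have : max 0 (1 - dot3 u u / K ^ 2) = 0 := by
    refine max_eq_left ?_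
    rw [sub_nonpos, le_div_iff₀ (by positivity), one_mul]
    exact hu
  rw [this, zero_pow three_ne_zero, mul_zero]

/-- The bump vanishes as soon as ONE coordinate is at least `K` in absolute value. -/
theorem bump_eq_zero_of_coord {K : ℝ} (hK : 0 < K) {u : Fin 3 → ℝ} (j : Fin 3) (hu : K ≤ |u j|) :
    bump K u = 0 := by
  refine bump_eq_zero hK (le_trans ?_ (sq_le_dot3_self u j))
  rw [← sq_abs (u j)]
  exact pow_le_pow_left₀ hK.le hu 2

/-- The bump is positive at points with `|u|² < K²`. -/
theorem bump_pos {K : ℝ} (hK : 0 < K) {u : Fin 3 → ℝ} (hu : dot3 u u < K ^ 2) : 0 < bump K u := by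
  unfold bump
  refine mul_pos (div_pos bumpConst_pos (pow_pos hK _)) (pow_pos ?_ _)
  rw [lt_max_iff]; right
  rw [sub_pos, div_lt_one (by positivity)]
  exact hu

/-- The mollified density is `C²`. -/
theorem contDiff_dens {N : ℕ} (x : Fin N → EuclideanSpace ℝ (Fin 3)) (K : ℝ) :
    ContDiff ℝ 2 (dens x K) := by
  unfold dens
  refine ContDiff.sum fun i _ => (contDiff_bump K).comp ?_
  exact contDiff_pi.2 fun j => (contDiff_apply ℝ ℝ j).sub contDiff_const

/-- The mollified density is nonnegative. -/
theorem dens_nonneg {N : ℕ} (x : Fin N → EuclideanSpace ℝ (Fin 3)) {K : ℝ} (hK : 0 < K)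
    (y : Fin 3 → ℝ) : 0 ≤ dens x K y :=
  Finset.sum_nonneg fun _ _ => bump_nonneg hK _

/-- The lateral kernel is nonnegative. -/
theorem eta_nonneg (L : ℝ) (z : ℝ × ℝ) : 0 ≤ eta L z := by
  unfold eta
  exact mul_nonneg (div_nonneg (by norm_num) (by positivity)) (pow_nonneg (le_max_left _ _) _)

/-- The lateral kernel is continuous. -/
theorem continuous_eta (L : ℝ) : Continuous (eta L) := by
  unfold eta; fun_prop

/-- The lateral kernel vanishes where one coordinate is at least `L` in absolute value. -/
theorem eta_eq_zero_of_coord {L : ℝ} (hL : 0 < L) {z : ℝ × ℝ} (hz : L ≤ |z.1| ∨ L ≤ |z.2|) :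
    eta L z = 0 := by
  unfold eta
  have hsq : L ^ 2 ≤ z.1 ^ 2 + z.2 ^ 2 := by
    rcases hz with h | h
    · have := pow_le_pow_left₀ hL.le h 2
      rw [sq_abs] at this
      nlinarith [sq_nonneg z.2]
    · have := pow_le_pow_left₀ hL.le h 2
      rw [sq_abs] at this
      nlinarith [sq_nonneg z.1]
  have : max 0 (1 - (z.1 ^ 2 + z.2 ^ 2) / L ^ 2) = 0 := by
    refine max_eq_left ?_
    rw [sub_nonpos, le_div_iff₀ (by positivity), one_mul]
    exact hsq
  rw [this, zero_pow three_ne_zero, mul_zero]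

/-! ### (D3) nonnegativity and (D2) compact support of `smooth` -/

/-- (D3) The doubly mollified density is nonnegative. -/
theorem smooth_nonneg {N : ℕ} (x : Fin N → EuclideanSpace ℝ (Fin 3)) {K : ℝ} (hK : 0 < K) (L : ℝ)
    (y : Fin 3 → ℝ) : 0 ≤ smooth x K L y := by
  unfold smooth
  exact integral_nonneg fun z => mul_nonneg (eta_nonneg L z) (dens_nonneg x hK _)

/-- A radius beyond which every bump of the configuration vanishes (sup norm). -/
theorem dens_eq_zero_of_coord {N : ℕ} (x : Fin N → EuclideanSpace ℝ (Fin 3)) {K : ℝ} (hK : 0 < K)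
    (y : Fin 3 → ℝ) (j : Fin 3) (hy : K + ∑ i : Fin N, ∑ l : Fin 3, |x i l| ≤ |y j|) :
    dens x K y = 0 := by
  unfold dens
  refine Finset.sum_eq_zero fun i _ => bump_eq_zero_of_coord hK j ?_
  have hi : |x i j| ≤ ∑ i : Fin N, ∑ l : Fin 3, |x i l| :=
    le_trans (Finset.single_le_sum (f := fun l => |x i l|) (fun _ _ => abs_nonneg _)
      (Finset.mem_univ j))
      (Finset.single_le_sum (f := fun i' => ∑ l : Fin 3, |x i' l|)
        (fun _ _ => Finset.sum_nonneg fun _ _ => abs_nonneg _) (Finset.mem_univ i))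
  have := abs_sub_abs_le_abs_sub (y j) (x i j)
  simp only
  linarith

/-- (D2) The doubly mollified density has compact support (it vanishes outside an explicit sup-norm ball). -/
theorem hasCompactSupport_smooth {N : ℕ} (x : Fin N → EuclideanSpace ℝ (Fin 3)) {K L : ℝ}
    (hK : 0 < K) (hL : 0 < L) : HasCompactSupport (smooth x K L) := by
  set R : ℝ := K + L + ∑ i : Fin N, ∑ l : Fin 3, |x i l| with hR
  refine HasCompactSupport.intro (isCompact_closedBall (0 : Fin 3 → ℝ) R) fun y hy => ?_
  rw [Metric.mem_closedBall, dist_zero_right, not_le] at hy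
  -- some coordinate of `y` is large
  obtain ⟨j, hj⟩ : ∃ j : Fin 3, R < |y j| := by
    by_contra h
    push Not at h
    have : ‖y‖ ≤ R := (pi_norm_le_iff_of_nonneg (by positivity)).2 fun j => by
      rw [Real.norm_eq_abs]; exact h j
    linarith
  unfold smooth
  refine integral_eq_zero_of_ae (Filter.Eventually.of_forall fun z => ?_)
  simp only [Pi.zero_apply]
  by_cases hz : L ≤ |z.1| ∨ L ≤ |z.2|
  · rw [eta_eq_zero_of_coord hL hz, zero_mul]
  · push Not at hz
    rw [dens_eq_zero_of_coord x hK _ j ?_, mul_zero]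
    have hzj : |(![z.1, z.2, 0] : Fin 3 → ℝ) j| ≤ L := by
      fin_cases j <;> simp [hz.1.le, hz.2.le, hL.le]
    have := abs_sub_abs_le_abs_sub (y j) ((![z.1, z.2, 0] : Fin 3 → ℝ) j)
    linarith

/-! ### (D1) `smooth` is `C²` -/

/-- The radius of a (sup-norm) ball in the lateral plane outside which the density of the configuration,
read at any height, vanishes. -/
theorem dens_vec_eq_zero {N : ℕ} (x : Fin N → EuclideanSpace ℝ (Fin 3)) {K : ℝ} (hK : 0 < K) (p : ℝ)
    (ξ : ℝ × ℝ) (hξ : ξ ∉ Metric.closedBall (0 : ℝ × ℝ) (K + ∑ i : Fin N, ∑ l : Fin 3, |x i l|)) :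
    dens x K (![ξ.1, ξ.2, p] : Fin 3 → ℝ) = 0 := by
  rw [Metric.mem_closedBall, dist_zero_right, Prod.norm_def, max_le_iff, not_and_or,
    Real.norm_eq_abs, Real.norm_eq_abs, not_le, not_le] at hξ
  rcases hξ with h | h
  · exact dens_eq_zero_of_coord x hK _ 0 (by simpa using h.le)
  · exact dens_eq_zero_of_coord x hK _ 1 (by simpa using h.le)

/-- `smooth` as a convolution on the lateral plane `ℝ × ℝ` with the height as a parameter. -/
theorem smooth_eq_convolution {N : ℕ} (x : Fin N → EuclideanSpace ℝ (Fin 3)) (K L : ℝ) :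
    smooth x K L = (fun q : ℝ × (ℝ × ℝ) =>
        (eta L ⋆[ContinuousLinearMap.mul ℝ ℝ, volume]
          (fun ξ : ℝ × ℝ => dens x K (![ξ.1, ξ.2, q.1] : Fin 3 → ℝ))) q.2) ∘
      fun y : Fin 3 → ℝ => (y 2, (y 0, y 1)) := by
  funext y
  simp only [Function.comp_apply, convolution_def, ContinuousLinearMap.mul_apply']
  unfold smooth
  congr 1
  funext z
  congr 2
  funext j
  fin_cases j <;> simp

/-- (D1) The doubly mollified density is `C²`: a convolution on the lateral plane with the height as a `C²` parameter. -/
theorem contDiff_smooth {N : ℕ} (x : Fin N → EuclideanSpace ℝ (Fin 3)) {K : ℝ} (L : ℝ) (hK : 0 < K) :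
    ContDiff ℝ 2 (smooth x K L) := by
  rw [smooth_eq_convolution]
  have hlin : ContDiff ℝ 2 (fun y : Fin 3 → ℝ => (y 2, (y 0, y 1))) :=
    (contDiff_apply ℝ ℝ 2).prodMk ((contDiff_apply ℝ ℝ 0).prodMk (contDiff_apply ℝ ℝ 1))
  refine ContDiff.comp ?_ hlin
  -- the convolution with parameter
  set R : ℝ := K + ∑ i : Fin N, ∑ l : Fin 3, |x i l| with hR
  have hg : ContDiffOn ℝ 2 (↿fun (p : ℝ) (ξ : ℝ × ℝ) => dens x K (![ξ.1, ξ.2, p] : Fin 3 → ℝ))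
      (univ ×ˢ univ) := by
    have h3 : ContDiff ℝ 2 (fun q : ℝ × (ℝ × ℝ) => (![q.2.1, q.2.2, q.1] : Fin 3 → ℝ)) := by
      refine contDiff_pi.2 fun j => ?_
      fin_cases j <;> simp <;> fun_prop
    exact ((contDiff_dens x K).comp h3).contDiffOn
  have h := contDiffOn_convolution_right_with_param (𝕜 := ℝ) (μ := (volume : Measure (ℝ × ℝ)))
    (ContinuousLinearMap.mul ℝ ℝ) (f := eta L) isOpen_univ (isCompact_closedBall (0 : ℝ × ℝ) R)
    (fun p ξ _ hξ => dens_vec_eq_zero x hK p ξ hξ) (continuous_eta L).locallyIntegrable hg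
  rw [univ_prod_univ, contDiffOn_univ] at h
  exact h

end Summit.Ventures.Crystal3D.Theorems

end
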